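import Mathlib
import Summits.Ventures.PercRepro2.KPrimeReduction
import Summits.Ventures.PercRepro2.KPrimeSure
import Summits.Ventures.PercRepro2.KPrimeEdgeSteps
import Summits.Ventures.PercRepro2.KPrimePendantLemmas
import Summits.Ventures.PercRepro2.KPrimeVYDict
import Summits.Ventures.PercRepro2.KPrimePendantB
import Summits.Ventures.PercRepro2.KPrimeLeakPendant
import Summits.Ventures.PercRepro2.KPrimeLeakLinear
import Summits.Ventures.PercRepro2.KPrimeDelProb

/-!
# The `(0,1)`-piece of the GLUE form is a theorem: the `(0,1)`-share of `N` does not fall when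
`a₁`'s root grows by `z`
(blind cell PercRepro2, mine-c g37; `conjectures/MINE-C.md` §46.8 (ii), §46.9)

`P⁰((0,1)) · P¹¹(N) ≤ P¹¹((0,1)) · P⁰(N)` — the termwise half `O1_/·D₀ ≥ O1·D₀_/` of the glue
(0 / 377 + 0 / 2,600 in census).  Two steps.  **PA–Harris in the base world**
(`cls01_avoid_pa_harris`): for any vertex `z ∉ {a₂, v}`, with `Z = {z ↮ {a₂, v}}`,
`P((0,1) ∩ Z) · P(N) ≥ P((0,1)) · P(N ∩ Z)` — fibred over the cluster `K = C(a₁)` (which avoids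
`{a₂, v}` on `N`), `(0,1) = {y ∈ K} ∩ {a₂ ↮ v}` and `Z` have the fibre functionals
`1[y ∈ K]·delProb {a₂ ↮ v} K` and `delProb Z K`, both increasing in `K`, the joint fibre
probability is at least their product (Harris on the deleted graph, `delProb_mul_le_delProb_inter`),
and the law of the avoided cluster is positively associated (`bhk_induced`).  **The leak**
(`glue_piece_o1`): in the world `p[e₂ ↦ 1]` (`b` a sure leaf at `z`) the glued world is the edge
`e₁ = {b, a₁}` pinned open; by the flip dictionary `P¹¹(N) = P¹⁰(N ∩ Z)` and
`P¹¹((0,1)) ≥ P¹⁰((0,1) ∩ Z)`, while the base masses of `p¹⁰` are those of `p⁰`.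
-/

namespace Summit.Ventures.PercRepro2

namespace KPrime

variable {V : Type*} {E : Type*} [Fintype E] [DecidableEq E] [Fintype V] [DecidableEq V]
  {R : Type*} [Field R] [LinearOrder R] [IsStrictOrderedRing R]

section PAHarris

variable {ends : E → Sym2 V} {a₁ a₂ v y z : V} {p : E → R}

omit [Fintype E] [DecidableEq E] [Fintype V] [Field R] [LinearOrder R] [IsStrictOrderedRing R] in
/-- `(0,1) = {y ∈ C(a₁)} ∩ {a₂ ↮ v} ∩ N`. -/
lemma cls01_eq_clusterIn_inter :
    cls01 ends a₁ a₂ v y =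
      clusterInEvent ends a₁ {K : Set V | y ∈ K} ∩ avoidAll ends a₂ {v} ∩
        avoidAll ends a₁ {a₂, v} := by
  ext ω
  simp only [cls01, S, Set.mem_inter_iff, Set.mem_compl_iff, mem_connEvent, mem_clusterInEvent,
    Set.mem_setOf_eq, mem_cluster, avoidAll, Finset.mem_insert, Finset.mem_singleton,
    forall_eq_or_imp, forall_eq]
  constructor
  · rintro ⟨⟨hv, hy⟩, ha, hav⟩
    exact ⟨⟨hy, hav⟩, fun h => ha (conn_symm h), hv⟩
  · rintro ⟨⟨hy, hav⟩, ha, hv⟩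
    exact ⟨⟨hv, hy⟩, fun h => ha (conn_symm h), hav⟩

omit [Fintype E] [DecidableEq E] [Fintype V] [DecidableEq V] [Field R] [LinearOrder R]
  [IsStrictOrderedRing R] in
/-- `avoidAll` is a lower set. -/
lemma isLowerSet_avoidAll (s : V) (X : Finset V) : IsLowerSet (avoidAll ends s X) :=
  fun _ _ h hω x hx hc => hω x hx (conn_mono h hc)

/-- **PA–Harris in the base world**: for `z ∉ {a₂, v}` and `Z = {z ↮ {a₂, v}}`,
`P((0,1)) · P(N ∩ Z) ≤ P((0,1) ∩ Z) · P(N)`. -/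
theorem cls01_avoid_pa_harris (hp : IsProbVec p) (hza₂ : z ≠ a₂) (hzv : z ≠ v) :
    prob p (cls01 ends a₁ a₂ v y) * prob p (N ends a₁ a₂ v ∩ avoidAll ends z {a₂, v}) ≤
      prob p (cls01 ends a₁ a₂ v y ∩ avoidAll ends z {a₂, v}) * prob p (N ends a₁ a₂ v) := by
  classical
  set X : Finset V := {a₂, v} with hX
  set A : Set (Config E) := avoidAll ends a₂ {v} with hA
  set Z : Set (Config E) := avoidAll ends z X with hZ
  set 𝓤y : Set (Set V) := {K : Set V | y ∈ K} with h𝓤y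
  have hzX : z ∉ X := by simp [hX, hza₂, hzv]
  -- deletion stability of `A`, `Z`, `A ∩ Z` along the avoided cluster of `a₁`
  have hAst : ∀ ω : Config E, ω ∈ avoidAll ends a₁ X →
      (ω ∈ A ↔ delConfig ends (cluster ends ω a₁) ω ∈ A) := by
    intro ω hω
    -- `{a₂ ↮ v}` is the avoidance of `a₂` of the set `{v}`; `a₂ ∉ cluster a₁` on `N`
    have ha₂K : a₂ ∉ cluster ends ω a₁ := fun h => hω a₂ (by simp [hX]) h
    have e := cluster_delConfig_cluster (ends := ends) (ω := ω) (s := a₁) ha₂K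
    simp only [hA, avoidAll, Set.mem_setOf_eq, Finset.mem_singleton, forall_eq]
    constructor
    · intro h hc
      have hc' : v ∈ cluster ends (delConfig ends (cluster ends ω a₁) ω) a₂ := hc
      rw [e] at hc'; exact h hc'
    · intro h hc
      have hc' : v ∈ cluster ends ω a₂ := hc
      rw [← e] at hc'; exact h hc'
  have hZst : ∀ ω : Config E, ω ∈ avoidAll ends a₁ X →
      (ω ∈ Z ↔ delConfig ends (cluster ends ω a₁) ω ∈ Z) :=
    fun ω hω => deletionStable_avoidAll a₁ z hzX hω
  have hAZst : ∀ ω : Config E, ω ∈ avoidAll ends a₁ X →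
      (ω ∈ A ∩ Z ↔ delConfig ends (cluster ends ω a₁) ω ∈ A ∩ Z) := by
    intro ω hω
    simp only [Set.mem_inter_iff, hAst ω hω, hZst ω hω]
  -- the three masses as expectations over the cluster of `a₁`
  have e1 := prob_clusterIn_inter_avoid_inter_eq_expect p ends a₁ (X := X) 𝓤y A hAst
  have e2 := prob_clusterIn_inter_avoid_inter_eq_expect p ends a₁ (X := X) Set.univ Z hZst
  have e3 := prob_clusterIn_inter_avoid_inter_eq_expect p ends a₁ (X := X) 𝓤y (A ∩ Z) hAZst
  -- the functionals
  set gA := delProb p ends A with hgA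
  set gZ := delProb p ends Z with hgZ
  have hgA_mono : Monotone gA := delProb_mono hp (isLowerSet_avoidAll a₂ {v})
  have hgZ_mono : Monotone gZ := delProb_mono hp (isLowerSet_avoidAll z X)
  have hgA0 : ∀ W, 0 ≤ gA W := fun W => delProb_nonneg hp A W
  have hgZ0 : ∀ W, 0 ≤ gZ W := fun W => delProb_nonneg hp Z W
  have hF₁ : Monotone (fun K : Set V => 𝓤y.indicator (1 : Set V → R) K * gA K) := by
    intro K K' h
    have h1 := monotone_indicator_one_of_isUpperSet (R := R) (isUpperSet_mem y) h
    have h2 := hgA_mono h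
    have h3 : 0 ≤ 𝓤y.indicator (1 : Set V → R) K := Set.indicator_apply_nonneg fun _ => zero_le_one
    exact mul_le_mul h1 h2 (hgA0 K) (le_trans h3 h1)
  have hF₁0 : ∀ K, 0 ≤ 𝓤y.indicator (1 : Set V → R) K * gA K := fun K =>
    mul_nonneg (Set.indicator_apply_nonneg fun _ => zero_le_one) (hgA0 K)
  -- BHK 1.3 for the avoided cluster of `a₁`
  have key := bhk_induced p hp ends a₁ hF₁ hgZ_mono hF₁0 hgZ0 Finset.univ X X
    (Finset.subset_univ _) (Finset.subset_univ _)
  simp only [Finset.inter_self, Finset.union_self, REvent_univ] at key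
  have e : ∀ F : Set V → R,
      clusterObs ends Finset.univ a₁ F * (avoidAll ends a₁ X).indicator 1 =
        fun ω => F (cluster ends ω a₁) * (avoidAll ends a₁ X).indicator 1 ω := by
    intro F
    funext ω
    simp only [Pi.mul_apply, clusterObs_apply, clusterIn_univ]
  rw [e, e, e] at key
  simp only [Pi.mul_apply] at key
  -- Harris inside the fibre: `gA · gZ ≤ delProb (A ∩ Z)`
  have hjoint : expect p (fun ω => 𝓤y.indicator (1 : Set V → R) (cluster ends ω a₁) *
      gA (cluster ends ω a₁) * gZ (cluster ends ω a₁) * (avoidAll ends a₁ X).indicator 1 ω) ≤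
      expect p (fun ω => 𝓤y.indicator (1 : Set V → R) (cluster ends ω a₁) *
        delProb p ends (A ∩ Z) (cluster ends ω a₁) * (avoidAll ends a₁ X).indicator 1 ω) := by
    refine expect_mono hp fun ω => ?_
    have hind : 0 ≤ 𝓤y.indicator (1 : Set V → R) (cluster ends ω a₁) :=
      Set.indicator_apply_nonneg fun _ => zero_le_one
    have hav : 0 ≤ (avoidAll ends a₁ X).indicator (1 : Config E → R) ω :=
      Set.indicator_apply_nonneg fun _ => zero_le_one
    have hh : gA (cluster ends ω a₁) * gZ (cluster ends ω a₁) ≤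
        delProb p ends (A ∩ Z) (cluster ends ω a₁) :=
      delProb_mul_le_delProb_inter (ends := ends) hp (B₁ := A) (B₂ := Z)
        (isLowerSet_avoidAll (ends := ends) a₂ {v}) (isLowerSet_avoidAll (ends := ends) z X)
        (cluster ends ω a₁)
    calc 𝓤y.indicator (1 : Set V → R) (cluster ends ω a₁) * gA (cluster ends ω a₁) *
          gZ (cluster ends ω a₁) * (avoidAll ends a₁ X).indicator 1 ω
        = 𝓤y.indicator (1 : Set V → R) (cluster ends ω a₁) *
            (gA (cluster ends ω a₁) * gZ (cluster ends ω a₁)) *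
            (avoidAll ends a₁ X).indicator 1 ω := by ring
      _ ≤ 𝓤y.indicator (1 : Set V → R) (cluster ends ω a₁) *
            delProb p ends (A ∩ Z) (cluster ends ω a₁) * (avoidAll ends a₁ X).indicator 1 ω := by
          gcongr
  -- translate the expectations back into masses
  have e1' : expect p (fun ω => 𝓤y.indicator (1 : Set V → R) (cluster ends ω a₁) *
      gA (cluster ends ω a₁) * (avoidAll ends a₁ X).indicator 1 ω) = prob p (cls01 ends a₁ a₂ v y) := by
    rw [cls01_eq_clusterIn_inter, ← hX, ← hA, ← h𝓤y, e1]
  have e2' : expect p (fun ω => gZ (cluster ends ω a₁) * (avoidAll ends a₁ X).indicator 1 ω) =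
      prob p (N ends a₁ a₂ v ∩ avoidAll ends z {a₂, v}) := by
    have : N ends a₁ a₂ v ∩ avoidAll ends z {a₂, v} =
        clusterInEvent ends a₁ Set.univ ∩ Z ∩ avoidAll ends a₁ X := by
      ext ω
      simp only [Set.mem_inter_iff, mem_clusterInEvent, Set.mem_univ, true_and, hZ, hX, N]
      exact and_comm
    rw [this, e2]
    congr 1
    funext ω
    simp
  have e3' : expect p (fun ω => 𝓤y.indicator (1 : Set V → R) (cluster ends ω a₁) *
      delProb p ends (A ∩ Z) (cluster ends ω a₁) * (avoidAll ends a₁ X).indicator 1 ω) =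
      prob p (cls01 ends a₁ a₂ v y ∩ avoidAll ends z {a₂, v}) := by
    have : cls01 ends a₁ a₂ v y ∩ avoidAll ends z {a₂, v} =
        clusterInEvent ends a₁ 𝓤y ∩ (A ∩ Z) ∩ avoidAll ends a₁ X := by
      rw [cls01_eq_clusterIn_inter, ← hX, ← hA, ← h𝓤y, ← hZ]
      ext ω
      simp only [Set.mem_inter_iff]
      tauto
    rw [this, e3]
  have hN : prob p (avoidAll ends a₁ X) = prob p (N ends a₁ a₂ v) := rfl
  rw [e1', e2', hN] at key
  have key2 : expect p (fun ω => 𝓤y.indicator (1 : Set V → R) (cluster ends ω a₁) *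
      gA (cluster ends ω a₁) * gZ (cluster ends ω a₁) * (avoidAll ends a₁ X).indicator 1 ω) *
      prob p (N ends a₁ a₂ v) ≤
      prob p (cls01 ends a₁ a₂ v y ∩ avoidAll ends z {a₂, v}) * prob p (N ends a₁ a₂ v) := by
    rw [← e3']
    exact mul_le_mul_of_nonneg_right hjoint (prob_nonneg hp _)
  exact le_trans key key2

end PAHarris

section Leak

variable {ends : E → Sym2 V} {a₁ a₂ b v y z : V} {e₁ e₂ : E} {p : E → R}

omit [Fintype E] [Fintype V] [DecidableEq V] [IsStrictOrderedRing R] in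
/-- On the sure part of `p[e₂ ↦ 1][e₁ ↦ 0]` the leak `e₂` is open. -/
lemma open_e₂_of_sure (hne : e₁ ≠ e₂) {ω : Config E}
    (hω : oneConfig (Function.update (Function.update p e₂ 1) e₁ 0) ≤ ω) : ω e₂ = true := by
  have h := hω e₂
  have h1 : Function.update (Function.update p e₂ 1) e₁ 0 e₂ = 1 := by
    simp [Function.update_of_ne hne.symm]
  simp only [oneConfig, h1, decide_true] at h
  revert h
  cases ω e₂ <;> simp

omit [Fintype E] [Fintype V] [DecidableEq V] [Field R] [LinearOrder R]
  [IsStrictOrderedRing R] in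
/-- With `e₁ = {b, a₁}` open on top of `ω'` (where `b` is a leaf at `z` by the open `e₂`),
`a₁ ↔ x` is `a₁ ↔ x` or `z ↔ x` in `ω'`. -/
lemma conn_a₁_update_iff (hb : ∀ f, b ∈ ends f → f = e₁ ∨ f = e₂) (h₁ : ends e₁ = s(b, a₁))
    (h₂ : ends e₂ = s(b, z)) (hne : e₁ ≠ e₂) {ω' : Config E} (hf : ω' e₁ = false)
    (hg : ω' e₂ = true) {x : V} (hx : x ≠ b) :
    Conn ends (Function.update ω' e₁ true) a₁ x ↔ Conn ends ω' a₁ x ∨ Conn ends ω' z x := by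
  have hb' : ∀ f, b ∈ ends f → f = e₂ ∨ f = e₁ := fun f h => (hb f h).symm
  have hbz : ∀ {s : V}, s ≠ b → (Conn ends ω' s b ↔ Conn ends ω' s z) := fun hs =>
    conn_b_iff_conn_x₁ (f := e₂) (g := e₁) (x₁ := z) hb' h₂ hne.symm hf hg hs
  rw [OneEdge.conn_update_true_iff h₁]
  constructor
  · rintro (h | ⟨_, h⟩ | ⟨_, h⟩)
    · exact Or.inl h
    · exact Or.inl h
    · exact Or.inr (conn_symm ((hbz hx).1 (conn_symm h)))
  · rintro (h | h)
    · exact Or.inl h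
    · exact Or.inr (Or.inr ⟨conn_refl _ _ _, conn_symm ((hbz hx).2 (conn_symm h))⟩)

omit [Fintype V] [IsStrictOrderedRing R] in
/-- **The leak dictionary for `N`**: `P¹¹(N) = P¹⁰(N ∩ {z ↮ {a₂, v}})`. -/
lemma prob_glued_N_eq (hb : ∀ f, b ∈ ends f → f = e₁ ∨ f = e₂) (h₁ : ends e₁ = s(b, a₁))
    (h₂ : ends e₂ = s(b, z)) (hne : e₁ ≠ e₂) (hba₂ : b ≠ a₂) (hbv : b ≠ v) :
    prob (Function.update (Function.update p e₂ 1) e₁ 1) (N ends a₁ a₂ v) =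
      prob (Function.update (Function.update p e₂ 1) e₁ 0)
        (N ends a₁ a₂ v ∩ avoidAll ends z {a₂, v}) := by
  have he : Function.update (Function.update p e₂ 1) e₁ 0 e₁ ≠ 1 := by simp
  have h11 : Function.update (Function.update p e₂ 1) e₁ 1 =
      Function.update (Function.update (Function.update p e₂ 1) e₁ 0) e₁ 1 := by
    rw [Function.update_idem]
  have h10 : Function.update (Function.update p e₂ 1) e₁ 0 =
      Function.update (Function.update (Function.update p e₂ 1) e₁ 0) e₁ 0 := by
    rw [Function.update_idem]
  rw [h11]
  conv_rhs => rw [h10]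
  apply prob_update_one_eq_update_zero_of_iff he
  intro ω hω
  have hω₂ : ω e₂ = true := open_e₂_of_sure hne hω
  set ω' := Function.update ω e₁ false with hω'
  have hf : ω' e₁ = false := by simp [hω']
  have hg : ω' e₂ = true := by simp [hω', Function.update_of_ne hne.symm, hω₂]
  have hup : Function.update ω e₁ true = Function.update ω' e₁ true := by
    simp [hω', Function.update_idem]
  rw [hup]
  simp only [N, avoidAll, Set.mem_inter_iff, Set.mem_setOf_eq, Finset.mem_insert,
    Finset.mem_singleton, forall_eq_or_imp, forall_eq]
  rw [conn_a₁_update_iff hb h₁ h₂ hne hf hg (Ne.symm hba₂),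
    conn_a₁_update_iff hb h₁ h₂ hne hf hg (Ne.symm hbv)]
  tauto

omit [Fintype V] in
/-- **The leak dictionary for `(0,1)`**: `P¹⁰((0,1) ∩ {z ↮ {a₂, v}}) ≤ P¹¹((0,1))` — on
`{z ↮ {a₂, v}}` opening the bridge keeps `v ∉ C₁`, `y ∈ C₁` and `a₂ ↮ {a₁, v}`. -/
lemma prob_glued_cls01_ge (hp : IsProbVec p) (hb : ∀ f, b ∈ ends f → f = e₁ ∨ f = e₂)
    (h₁ : ends e₁ = s(b, a₁)) (h₂ : ends e₂ = s(b, z)) (hne : e₁ ≠ e₂)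
    (hba₂ : b ≠ a₂) (hbv : b ≠ v) :
    prob (Function.update (Function.update p e₂ 1) e₁ 0)
        (cls01 ends a₁ a₂ v y ∩ avoidAll ends z {a₂, v}) ≤
      prob (Function.update (Function.update p e₂ 1) e₁ 1) (cls01 ends a₁ a₂ v y) := by
  have hb' : ∀ f, b ∈ ends f → f = e₂ ∨ f = e₁ := fun f h => (hb f h).symm
  have hp'' : IsProbVec (Function.update (Function.update p e₂ 1) e₁ 0) :=
    (hp.update e₂ zero_le_one le_rfl).update e₁ le_rfl zero_le_one
  have he : Function.update (Function.update p e₂ 1) e₁ 0 e₁ ≠ 1 := by simp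
  -- the glued mass as the mass of the pulled-back event in the pendant-at-`z` world
  set B' : Set (Config E) := {ω | Function.update ω e₁ true ∈ cls01 ends a₁ a₂ v y} with hB'
  have hdict : prob (Function.update (Function.update p e₂ 1) e₁ 1) (cls01 ends a₁ a₂ v y) =
      prob (Function.update (Function.update p e₂ 1) e₁ 0) B' := by
    have h11 : Function.update (Function.update p e₂ 1) e₁ 1 =
        Function.update (Function.update (Function.update p e₂ 1) e₁ 0) e₁ 1 := by
      rw [Function.update_idem]
    have h10 : Function.update (Function.update p e₂ 1) e₁ 0 =
        Function.update (Function.update (Function.update p e₂ 1) e₁ 0) e₁ 0 := by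
      rw [Function.update_idem]
    rw [h11]
    conv_rhs => rw [h10]
    apply prob_update_one_eq_update_zero_of_iff he
    intro ω _
    simp only [hB', Set.mem_setOf_eq, Function.update_idem]
  rw [hdict]
  -- the support of the pendant-at-`z` world
  have hcomm : Function.update (Function.update p e₂ 1) e₁ 0 =
      Function.update (Function.update p e₁ 0) e₂ 1 := Function.update_comm hne.symm _ _ _
  have hsupp : ∀ C : Set (Config E),
      prob (Function.update (Function.update p e₂ 1) e₁ 0) C =
        prob (Function.update (Function.update p e₂ 1) e₁ 0) (C ∩ closedEdge e₁ ∩ openEdge e₂) := by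
    intro C
    rw [← prob_update_zero_inter_closedEdge (Function.update p e₂ 1) C e₁]
    conv_lhs => rw [hcomm]
    rw [← prob_update_one_inter_openEdge (Function.update p e₁ 0) (C ∩ closedEdge e₁) e₂, ← hcomm]
  rw [hsupp (cls01 ends a₁ a₂ v y ∩ avoidAll ends z {a₂, v})]
  refine prob_mono hp'' ?_
  rintro ω ⟨⟨⟨hc, hZ⟩, hf⟩, hg⟩
  rw [mem_closedEdge] at hf
  rw [mem_openEdge] at hg
  have hle : ω ≤ Function.update ω e₁ true := by
    intro e
    by_cases he' : e = e₁
    · subst he'; simp [hf]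
    · simp [Function.update_of_ne he']
  have hbz : ∀ {s : V}, s ≠ b → (Conn ends ω s b ↔ Conn ends ω s z) := fun hs =>
    conn_b_iff_conn_x₁ (f := e₂) (g := e₁) (x₁ := z) hb' h₂ hne.symm hf hg hs
  simp only [hB', Set.mem_setOf_eq]
  simp only [cls01, S, Set.mem_inter_iff, Set.mem_compl_iff, mem_connEvent, avoidAll,
    Set.mem_setOf_eq, Finset.mem_insert, Finset.mem_singleton, forall_eq_or_imp, forall_eq] at hc hZ ⊢
  obtain ⟨⟨hv, hy⟩, ha₁, hav⟩ := hc
  obtain ⟨hza₂, hzv⟩ := hZ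
  refine ⟨⟨?_, conn_mono hle hy⟩, ?_, ?_⟩
  · rw [conn_a₁_update_iff hb h₁ h₂ hne hf hg (Ne.symm hbv)]
    rintro (h | h)
    · exact hv h
    · exact hzv h
  · rw [OneEdge.conn_update_true_iff h₁]
    rintro (h | ⟨h, _⟩ | ⟨h, _⟩)
    · exact ha₁ h
    · exact hza₂ (conn_symm ((hbz (Ne.symm hba₂)).1 h))
    · exact ha₁ h
  · rw [OneEdge.conn_update_true_iff h₁]
    rintro (h | ⟨h, _⟩ | ⟨h, _⟩)
    · exact hav h
    · exact hza₂ (conn_symm ((hbz (Ne.symm hba₂)).1 h))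
    · exact ha₁ h

/-- **The `(0,1)`-piece of the glue is a theorem**: with `b` attached to `a₁` by `e₁` and to `z`
by `e₂` (and to nothing else), `z ∉ {a₂, v}`,
`P⁰((0,1)) · P¹¹(N) ≤ P¹¹((0,1)) · P⁰(N)` (`P⁰ = p[e₂ ↦ 0]`, `P¹¹ = p[e₂ ↦ 1][e₁ ↦ 1]`):
the `(0,1)`-share of `N` does not fall when `a₁`'s root grows by `z`. -/
theorem glue_piece_o1 (hp : IsProbVec p) (hb : ∀ f, b ∈ ends f → f = e₁ ∨ f = e₂)
    (h₁ : ends e₁ = s(b, a₁)) (h₂ : ends e₂ = s(b, z)) (hne : e₁ ≠ e₂)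
    (hba₁ : b ≠ a₁) (hba₂ : b ≠ a₂) (hbv : b ≠ v) (hby : b ≠ y) (hza₂ : z ≠ a₂) (hzv : z ≠ v) :
    prob (Function.update p e₂ 0) (cls01 ends a₁ a₂ v y) *
        prob (Function.update (Function.update p e₂ 1) e₁ 1) (N ends a₁ a₂ v) ≤
      prob (Function.update (Function.update p e₂ 1) e₁ 1) (cls01 ends a₁ a₂ v y) *
        prob (Function.update p e₂ 0) (N ends a₁ a₂ v) := by
  have hb' : ∀ f, b ∈ ends f → f = e₂ ∨ f = e₁ := fun f h => (hb f h).symm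
  have hp'' : IsProbVec (Function.update (Function.update p e₂ 1) e₁ 0) :=
    (hp.update e₂ zero_le_one le_rfl).update e₁ le_rfl zero_le_one
  -- the base masses are those of the pendant-at-`z` world
  have hSX : ∀ x ∈ ({a₁, v} : Finset V), x ≠ b := fun x hx => by
    simp only [Finset.mem_insert, Finset.mem_singleton] at hx
    rcases hx with rfl | rfl
    · exact Ne.symm hba₁
    · exact Ne.symm hbv
  have hNX : ∀ x ∈ ({a₂, v} : Finset V), x ≠ b := fun x hx => by
    simp only [Finset.mem_insert, Finset.mem_singleton] at hx
    rcases hx with rfl | rfl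
    · exact Ne.symm hba₂
    · exact Ne.symm hbv
  have hS₁ : PendInv e₁ e₂ (S ends a₁ a₂ v) := pendInv_avoidAll hb h₁ hne (Ne.symm hba₂) hSX
  have hS₂ : PendInv e₂ e₁ (S ends a₁ a₂ v) := pendInv_avoidAll hb' h₂ hne.symm (Ne.symm hba₂) hSX
  have hN₁ : PendInv e₁ e₂ (N ends a₁ a₂ v) := pendInv_avoidAll hb h₁ hne (Ne.symm hba₁) hNX
  have hN₂ : PendInv e₂ e₁ (N ends a₁ a₂ v) := pendInv_avoidAll hb' h₂ hne.symm (Ne.symm hba₁) hNX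
  have hc01₁ : PendInv e₁ e₂ (cls01 ends a₁ a₂ v y) :=
    ((pendInv_connEvent hb h₁ hne (Ne.symm hba₁) (Ne.symm hbv)).compl.inter
      (pendInv_connEvent hb h₁ hne (Ne.symm hba₁) (Ne.symm hby))).inter hS₁
  have hc01₂ : PendInv e₂ e₁ (cls01 ends a₁ a₂ v y) :=
    ((pendInv_connEvent hb' h₂ hne.symm (Ne.symm hba₁) (Ne.symm hbv)).compl.inter
      (pendInv_connEvent hb' h₂ hne.symm (Ne.symm hba₁) (Ne.symm hby))).inter hS₂
  rw [← prob_pendantZ_eq_leakClosed hne hc01₁ hc01₂, ← prob_pendantZ_eq_leakClosed hne hN₁ hN₂,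
    prob_glued_N_eq hb h₁ h₂ hne hba₂ hbv]
  calc prob (Function.update (Function.update p e₂ 1) e₁ 0) (cls01 ends a₁ a₂ v y) *
        prob (Function.update (Function.update p e₂ 1) e₁ 0)
          (N ends a₁ a₂ v ∩ avoidAll ends z {a₂, v})
      ≤ prob (Function.update (Function.update p e₂ 1) e₁ 0)
          (cls01 ends a₁ a₂ v y ∩ avoidAll ends z {a₂, v}) *
          prob (Function.update (Function.update p e₂ 1) e₁ 0) (N ends a₁ a₂ v) :=
        cls01_avoid_pa_harris hp'' hza₂ hzv
    _ ≤ prob (Function.update (Function.update p e₂ 1) e₁ 1) (cls01 ends a₁ a₂ v y) *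
          prob (Function.update (Function.update p e₂ 1) e₁ 0) (N ends a₁ a₂ v) :=
        mul_le_mul_of_nonneg_right (prob_glued_cls01_ge hp hb h₁ h₂ hne hba₂ hbv)
          (prob_nonneg hp'' _)

end Leak

end KPrime

end Summit.Ventures.PercRepro2
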